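/-
COR-CM (cells pub-hodgecm / pub-hodgecm2) — HM-EQUALITY Δ2 / X3, row X3-Char item (F′) TREE SIDE, tower half: RATIONAL SCALAR
(central) elements of `U(V)` act TRIVIALLY on the Betti tower `Tower … V = colim_K H¹(X_K(ℂ); ℂ)` (port layers ≤ 45:
`Model/LevelTranslate`, `Model/TowerLevel`, `Model/TowerCarrier`, `Model/TowerAlgebra`, `Model/LiuDictionaryTower`).  Origin: seat `prover-pub-hodgecm-own-htheta-g8-0` (own-htheta
gen 8; X3 co-owner), 2026-08-23.  Theorems only: no definition, no instance, no named fact, no proof holes; nothing landed is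
edited or restated.  FRAMING: HC_CM is NOT proved; no COR-CM binder or pin is discharged; «Δ2 BRIDGE CLOSED» is NOT claimed.
-/
import Summits.HodgeConjecture.HodgeCM.Model.LiuDictionaryTower
import HarnessLib

set_option autoImplicit false

noncomputable section

/-!
# Rational central elements of `U(V)` act trivially on the Betti tower

For a rational unitary SCALAR `γ = z·1 ∈ U(V)(L⁺)` (`z ∈ L`, `z z̄ = 1`):
* §1 `pull_transMor_of_coe_eq_diagonal`: the rational translate `t_γ : X_{Δ₁} ⟶ X_{Δ₂}` of the model universe pulls back on
  Betti cohomology exactly like `t_1` — on complex points `t_γ(Δ₁[v]) = Δ₂[ι₁(z)·v] = Δ₂[v]` (`map_transMor_unif`, the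
  uniformisation is constant on punctured complex lines, `unif_smul`); `trPull_of_coe_eq_diagonal`: the same for the
  `ℂ`-linear pull-backs `trPull` of the tower levels.
* §2 `TowerCarrier.act_rationalToFinAdelic_of_coe_eq_diagonal`: its finite-adelic image `(γ)_f ∈ U(V)(𝔸_{L⁺,f})` is CENTRAL and
  acts as the IDENTITY on the tower: `act (γ)_f = id` (`(g • c) h = c (h g) = c ((γ)_f h) = t_γ^* … = t_1^* …` by the
  `U(V)(L⁺)`-equivariance of the level families, `TowerLevel.apply_eq_trPull`).
Use (X3-Char (F′)): §3–§4 turn §2 into a block-vanishing criterion («a rational scalar acts on `ω(μ, a)` by `c ≠ 1`»).  At the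
pin's AUTOMORPHIC character cut this criterion is VACUOUS — by [Liu21, App. D Step 3] `weilCoinv_finAdelicCenter` the `V`-centre
acts on `Ω(s, χ)` by `χ` itself for every compatible `s`, and `IsAutChar χ` makes `χ` trivial on rational points — so §2 is
recorded as the tower-side REASON the cut must be automorphic (a level-trivial non-automorphic `χ` has block `0`) and as a reusable
structural fact of the tower; it narrows nothing beyond (F).  Nothing here discharges `h418`; HC_CM is NOT proved.
-/

namespace Summit.HodgeConjecture.CorCM.Transposition.TowerCentre

open scoped Matrix
open Matrix Function Set
open NumberField CategoryTheory
open Literature.AlgebraicGeometry.Motives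
open Literature.AlgebraicGeometry.ShimuraVarieties
open Literature.AlgebraicGeometry.HodgeTheory
open Literature.NumberTheory.Automorphic
open Literature.NumberTheory.Automorphic.PicardCM
open Literature.NumberTheory.Transcendental (Arapura2012_Cor_15_4_6)
open HodgeCM HodgeCM.Model HodgeCM.Model.LevelTranslate HodgeCM.Model.TowerLevel HodgeCM.Model.TowerCarrier

variable {L : CMField} {ι₁ : (L : Type) →+* ℂ} {V : HermSpace3 L ι₁}

/-! ### §1. Scalar translates pull back like `t_1` -/

/-- **`t_γ^* = t_1^*` on `Hᵏ(X_{Δ₂}(ℂ); ℚ) → Hᵏ(X_{Δ₁}(ℂ); ℚ)` for a rational SCALAR `γ = z·1`**: on complex points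
`t_γ(Δ₁[v]) = Δ₂[γ^{ι₁} v] = Δ₂[ι₁(z)·v] = Δ₂[v] = t_1(Δ₁[v])` (the uniformisation is constant on punctured complex lines).
[folklore] -/
theorem pull_transMor_of_coe_eq_diagonal (hU : BallQuotientUniformisedDatum) (h₃ : CMAbelianVarietyRealised)
    (hHD : exists_isReal_hodgeModel) (hA : Arapura2012_Cor_15_4_6) {γ : GL (Fin 3) (L : Type)} (hγ : γ ∈ Urat V)
    {z : (L : Type)} (hz : z ≠ 0) (hγz : (γ : Matrix (Fin 3) (Fin 3) (L : Type)) = Matrix.diagonal fun _ => z)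
    {Δ₁ Δ₂ : Level V} (ht : TransCond γ Δ₁ Δ₂) (ht₁ : TransCond 1 Δ₁ Δ₂) (k : ℕ) :
    BettiUniverse.pull (transMor hU h₃ hHD hA hγ Δ₁ Δ₂ ht) k =
      BettiUniverse.pull (transMor hU h₃ hHD hA (Subgroup.one_mem (Urat V)) Δ₁ Δ₂ ht₁) k := by
  by_cases h : IsAnisotropic L V.Hm
  · have h₁ := (isAnisotropic_pmsCode_iff L ι₁ V Δ₁).2 h
    have h₂ := (isAnisotropic_pmsCode_iff L ι₁ V Δ₂).2 h
    refine pull_congr (map_eq_of_unif hU h₃ h₁ fun v hv ↦ ?_) k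
    have hv₂ : v ∈ (Var.ballDatum hU h₃ (pmsCode L ι₁ V Δ₂) h₂).cone := by
      simpa only [glι, map_one, Units.val_one, one_mulVec] using
        LevelCoveringTwist.mulVec_mem_cone (ballDatum_Hℂ_eq hU h₃ Δ₂ Δ₁ h₁ h₂)
          (map_ι₁_mem_realPoints hU h₃ (Subgroup.one_mem (Urat V)) Δ₂ h₂) hv
    rw [map_transMor_unif hU h₃ hHD hA hγ ht h hv, map_transMor_unif hU h₃ hHD hA _ ht₁ h hv]
    have h1 : (glι ι₁ γ : Matrix (Fin 3) (Fin 3) ℂ) *ᵥ v = (ι₁ z) • v := by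
      have hγ' : (glι ι₁ γ : Matrix (Fin 3) (Fin 3) ℂ) = Matrix.diagonal fun _ => ι₁ z := by
        change (γ : Matrix (Fin 3) (Fin 3) (L : Type)).map ι₁ = _
        rw [hγz, Matrix.diagonal_map (map_zero ι₁)]
      rw [hγ']
      ext i
      simp only [Matrix.mulVec_diagonal, Pi.smul_apply, smul_eq_mul]
    have h2 : (glι ι₁ (1 : GL (Fin 3) (L : Type)) : Matrix (Fin 3) (Fin 3) ℂ) *ᵥ v = v := by
      simp only [glι, map_one, Units.val_one, one_mulVec]
    rw [h1, h2]
    exact (Var.ballDatum hU h₃ (pmsCode L ι₁ V Δ₂) h₂).unif_smul ((map_ne_zero ι₁).2 hz) hv₂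
  · unfold transMor
    simp only [dif_neg h]

/-- the same for the `ℂ`-linear pull-backs `t_γ^*` between the tower's levels: `trPull γ = trPull 1` for a rational scalar `γ`.
[folklore] -/
theorem trPull_of_coe_eq_diagonal (hHD : exists_isReal_hodgeModel) (hI : hodgePQ_independent_of_hodgeModel)
    (hU : BallQuotientUniformisedDatum) (h₃ : CMAbelianVarietyRealised) (hA : Arapura2012_Cor_15_4_6) (γ : ↥(Urat V))
    {z : (L : Type)} (hz : z ≠ 0) (hγz : ((γ : GL (Fin 3) (L : Type)) : Matrix (Fin 3) (Fin 3) (L : Type)) = Matrix.diagonal fun _ => z)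
    {Δ₁ Δ₂ : Level V} (ht : TransCond (γ : GL (Fin 3) (L : Type)) Δ₁ Δ₂)
    (ht₁ : TransCond ((1 : ↥(Urat V)) : GL (Fin 3) (L : Type)) Δ₁ Δ₂) (k : ℕ) (x : Coh hHD hI hU h₃ Δ₂ k) :
    trPull hHD hI hU h₃ hA γ Δ₁ Δ₂ ht k x = trPull hHD hI hU h₃ hA 1 Δ₁ Δ₂ ht₁ k x := by
  change ((BettiUniverse.pull (transMor hU h₃ hHD hA γ.2 Δ₁ Δ₂ ht) k).baseChange ℂ) x =
    ((BettiUniverse.pull (transMor hU h₃ hHD hA (1 : ↥(Urat V)).2 Δ₁ Δ₂ ht₁) k).baseChange ℂ) x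
  rw [pull_transMor_of_coe_eq_diagonal hU h₃ hHD hA γ.2 hz hγz ht ht₁ k]

/-! ### §2. Rational central elements act trivially on the tower -/

/-- the finite-adelic image `(γ)_f` of a rational SCALAR `γ = z·1` is CENTRAL in `U(V)(𝔸_{L⁺,f})`. [folklore] -/
theorem rationalToFinAdelic_comm_of_coe_eq_diagonal (γ : ↥(Urat V)) {z : (L : Type)}
    (hγz : ((γ : GL (Fin 3) (L : Type)) : Matrix (Fin 3) (Fin 3) (L : Type)) = Matrix.diagonal fun _ => z)
    (g : ↥V.adelicFin) : g * TowerLevel.ρ V γ = TowerLevel.ρ V γ * g := by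
  apply Subtype.ext
  apply Units.ext
  change ((g : GL (Fin 3) (IsDedekindDomain.FiniteAdeleRing (𝓞 (L : Type)) (L : Type))) : Matrix _ _ _) *
      ((γ : GL (Fin 3) (L : Type)) : Matrix (Fin 3) (Fin 3) (L : Type)).map
        (algebraMap (L : Type) (IsDedekindDomain.FiniteAdeleRing (𝓞 (L : Type)) (L : Type))) =
    ((γ : GL (Fin 3) (L : Type)) : Matrix (Fin 3) (Fin 3) (L : Type)).map
        (algebraMap (L : Type) (IsDedekindDomain.FiniteAdeleRing (𝓞 (L : Type)) (L : Type))) *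
      ((g : GL (Fin 3) (IsDedekindDomain.FiniteAdeleRing (𝓞 (L : Type)) (L : Type))) : Matrix _ _ _)
  rw [hγz, Matrix.diagonal_map (map_zero _), ← Matrix.smul_one_eq_diagonal, Matrix.mul_smul, Matrix.mul_one,
    Matrix.smul_mul, Matrix.one_mul]

/-- conjugating a level by a CENTRAL element does nothing. [folklore] -/
theorem Level.conj_eq_of_comm (Γ : Level V) (hΓ : Γ.BelowConjThree) {g : ↥V.adelicFin}
    (hg : ∀ x : ↥V.adelicFin, x * g = g * x) : Γ.conj g hΓ = Γ :=
  Level.ext (Subgroup.ext fun x => by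
    rw [Level.K_conj, Level.mem_conjK_iff]
    constructor
    · rintro ⟨k, hk, rfl⟩
      rwa [← hg k, mul_assoc, mul_inv_cancel, mul_one]
    · intro hx
      exact ⟨x, hx, by rw [← hg x, mul_assoc, mul_inv_cancel, mul_one]⟩)

/-- **a rational SCALAR `γ = z·1 ∈ U(V)(L⁺)` acts as the IDENTITY on the Betti tower through its finite-adelic image**:
`act (γ)_f = id` on `Tower … V` — on a level family `c ∈ H_K`, `((γ)_f • c) h = t_1^* (c (h (γ)_f)) = t_1^* (c ((γ)_f h))`, and the
`U(V)(L⁺)`-equivariance `c h = t_γ^* (c ((γ)_f h))` (`TowerLevel.apply_eq_trPull`) together with `t_γ^* = t_1^*` (§1) close it.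
[folklore] -/
theorem act_rationalToFinAdelic_of_coe_eq_diagonal (hHD : exists_isReal_hodgeModel) (hI : hodgePQ_independent_of_hodgeModel)
    (hU : BallQuotientUniformisedDatum) (h₃ : CMAbelianVarietyRealised) (hA : Arapura2012_Cor_15_4_6) (γ : ↥(Urat V))
    {z : (L : Type)} (hz : z ≠ 0) (hγz : ((γ : GL (Fin 3) (L : Type)) : Matrix (Fin 3) (Fin 3) (L : Type)) = Matrix.diagonal fun _ => z)
    (x : Tower hHD hI hU h₃ hA V) : act hHD hI hU h₃ hA (TowerLevel.ρ V γ) x = x := by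
  have hc := rationalToFinAdelic_comm_of_coe_eq_diagonal γ hγz
  obtain ⟨Γ, hΓ, c, rfl⟩ := exists_ofLevel hHD hI hU h₃ hA x
  have eΓ : Γ.conj (TowerLevel.ρ V γ) hΓ = Γ := Level.conj_eq_of_comm Γ hΓ hc
  rw [act_ofLevel, ← ofLevel_castLevel hHD hI hU h₃ hA eΓ (hΓ.conj _) hΓ]
  congr 1
  apply Subtype.ext
  funext h
  have eh : Γ.conj (h * TowerLevel.ρ V γ) hΓ = Γ.conj h hΓ := by
    rw [Level.conj_mul]
    congr 1
  have ht_c : TransCond ((1 : ↥(Urat V)) : GL (Fin 3) (L : Type)) (Γ.conj h hΓ) (Γ.conj (h * TowerLevel.ρ V γ) hΓ) :=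
    transCond_one_of_eq eh.symm
  have r : Rel Γ γ h (h * TowerLevel.ρ V γ) := ⟨1, Γ.K.one_mem, by rw [mul_one, hc h]⟩
  rw [castLevel_apply, translate_apply,
    trPull_trPull hHD hI hU h₃ hA (show (1 : ↥(Urat V)) = 1 * 1 from (mul_one 1).symm) _ _ ht_c,
    apply_eq_trPull hHD hI hU h₃ hA c r (transCond_of_rel hΓ r),
    trPull_of_coe_eq_diagonal hHD hI hU h₃ hA γ hz hγz (transCond_of_rel hΓ r) ht_c]

/-- hence on the representation: `towerRep … V (γ)_f = id`. [folklore] -/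
theorem towerRep_rationalToFinAdelic_of_coe_eq_diagonal (hHD : exists_isReal_hodgeModel)
    (hI : hodgePQ_independent_of_hodgeModel) (hU : BallQuotientUniformisedDatum) (h₃ : CMAbelianVarietyRealised)
    (hA : Arapura2012_Cor_15_4_6) (γ : ↥(Urat V)) {z : (L : Type)} (hz : z ≠ 0)
    (hγz : ((γ : GL (Fin 3) (L : Type)) : Matrix (Fin 3) (Fin 3) (L : Type)) = Matrix.diagonal fun _ => z)
    (x : Tower hHD hI hU h₃ hA V) : towerRep hHD hI hU h₃ hA V (TowerLevel.ρ V γ) x = x :=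
  act_rationalToFinAdelic_of_coe_eq_diagonal hHD hI hU h₃ hA γ hz hγz x

/-! ### §3. Schur-type vanishing: a central element acting by a scalar `≠ 1` on the source and trivially on the target -/

section Schur

variable {G : Type*} [Group G]

/-- **a `ℂ[G]`-linear map out of a module on which `of g` acts by a scalar `c ≠ 1` into a module on which `of g` acts
trivially is `0`.** [folklore] -/
theorem linearMap_eq_zero_of_of_smul_eq (g : G) {c : ℂ} (hc : c ≠ 1) {M N : Type*} [AddCommGroup M]
    [Module (MonoidAlgebra ℂ G) M] [AddCommGroup N] [Module ℂ N] [Module (MonoidAlgebra ℂ G) N]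
    [IsScalarTower ℂ (MonoidAlgebra ℂ G) N]
    (hM : ∀ x : M, MonoidAlgebra.of ℂ G g • x = algebraMap ℂ (MonoidAlgebra ℂ G) c • x)
    (hN : ∀ y : N, MonoidAlgebra.of ℂ G g • y = y) (ψ : M →ₗ[MonoidAlgebra ℂ G] N) : ψ = 0 := by
  refine LinearMap.ext fun x => ?_
  have h1 : ψ (MonoidAlgebra.of ℂ G g • x) = ψ (algebraMap ℂ (MonoidAlgebra ℂ G) c • x) := by rw [hM x]
  rw [map_smul, map_smul, hN, algebraMap_smul] at h1
  have h2 : (c - 1) • ψ x = 0 := by rw [sub_smul, one_smul, ← h1, sub_self]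
  exact (smul_eq_zero.1 h2).resolve_left (sub_ne_zero.2 hc)

/-- **`block μ = ⊥` for a Liu–Albanese module datum on whose `H` a group element `g` acts trivially and on whose oscillator
modules `ω(μ, a)` it acts by scalars `c a ≠ 1`.** [folklore] -/
theorem block_eq_bot_of_of_smul_eq {Lvl : Type*} {Kof : Lvl → Subgroup G}
    (D : HodgeCM.Literature.Theta.LiuAlbaneseModuleDatum G Kof) (g : G) {μ : D.Char} (c : D.Adm μ → ℂ)
    (hc : ∀ a, c a ≠ 1) (hΩ : ∀ (a : D.Adm μ) (x : D.Ω μ a), MonoidAlgebra.of ℂ G g • x = algebraMap ℂ (MonoidAlgebra ℂ G) (c a) • x)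
    (hH : ∀ y : D.H, MonoidAlgebra.of ℂ G g • y = y) : D.block μ = ⊥ :=
  le_bot_iff.1 (HodgeCM.Literature.Theta.LiuAlbaneseModuleDatum.block_le fun a ψ => by
    rw [linearMap_eq_zero_of_of_smul_eq g (hc a) (hΩ a) hH ψ, LinearMap.range_zero, Submodule.restrictScalars_bot])

end Schur

/-! ### §4. At the tower dictionaries: `block μ = ⊥` when a rational scalar acts on every `ω(μ, a)` by a scalar `≠ 1` -/

section TowerDictionary

variable {Char : Type} {Adm : Char → Type} {Ω : (μ : Char) → Adm μ → Type}
    [∀ μ a, AddCommGroup (Ω μ a)] [∀ μ a, Module ℂ (Ω μ a)] [∀ μ a, Module (adelicAlgebra V) (Ω μ a)]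
    [∀ μ a, IsScalarTower ℂ (adelicAlgebra V) (Ω μ a)] {PhiMu : Char → Prop} {adm : Char → LiuCMSide → Prop}

/-- a rational scalar acts TRIVIALLY on the carrier `H` of every tower dictionary (§2, the scalar action named through the
dictionary's own instance field). [folklore] -/
theorem ofTower_rationalScalar_smul_eq (hHD : exists_isReal_hodgeModel) (hI : hodgePQ_independent_of_hodgeModel)
    (h₁ : BallQuotientUniformised) (h₃ : CMAbelianVarietyRealised) (hA : Arapura2012_Cor_15_4_6) (γ : ↥(Urat V))
    {z : (L : Type)} (hz : z ≠ 0) (hγz : ((γ : GL (Fin 3) (L : Type)) : Matrix (Fin 3) (Fin 3) (L : Type)) = Matrix.diagonal fun _ => z) :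
    ∀ y : (LiuDictionary.ofTower hHD hI h₁ h₃ hA V Char Adm Ω PhiMu adm).H,
      @HSMul.hSMul (MonoidAlgebra ℂ ↥V.adelicFin) _ _
          (@instHSMul _ _ (LiuDictionary.ofTower hHD hI h₁ h₃ hA V Char Adm Ω PhiMu adm).instH₃.toSMul)
          (MonoidAlgebra.of ℂ ↥V.adelicFin (TowerLevel.ρ V γ)) y = y := fun y =>
  (of_smul_eq_act hHD hI (ballQuotientUniformisedDatum_of h₁) h₃ hA (TowerLevel.ρ V γ) y).trans
    (act_rationalToFinAdelic_of_coe_eq_diagonal hHD hI (ballQuotientUniformisedDatum_of h₁) h₃ hA γ hz hγz y)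

/-- **`block μ = ⊥` for every tower dictionary whose oscillator modules `ω(μ, a)` carry a rational SCALAR `(z·1)_f` acting by
scalars `c a ≠ 1`** (e.g. `ω(μ, a)` a Weil-coinvariant module at a level-trivial NON-automorphic character), since
rational scalars act trivially on the Betti tower (§2); vacuous at an automorphic character cut. [folklore] -/
theorem block_ofTower_eq_bot_of_rationalScalar_smul (hHD : exists_isReal_hodgeModel)
    (hI : hodgePQ_independent_of_hodgeModel) (h₁ : BallQuotientUniformised) (h₃ : CMAbelianVarietyRealised)
    (hA : Arapura2012_Cor_15_4_6) (γ : ↥(Urat V)) {z : (L : Type)} (hz : z ≠ 0)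
    (hγz : ((γ : GL (Fin 3) (L : Type)) : Matrix (Fin 3) (Fin 3) (L : Type)) = Matrix.diagonal fun _ => z) {μ : Char}
    (c : Adm μ → ℂ) (hc : ∀ a, c a ≠ 1)
    (hΩ : ∀ (a : Adm μ) (x : Ω μ a), MonoidAlgebra.of ℂ ↥V.adelicFin (TowerLevel.ρ V γ) • x =
      algebraMap ℂ (adelicAlgebra V) (c a) • x) :
    (LiuDictionary.ofTower hHD hI h₁ h₃ hA V Char Adm Ω PhiMu adm).block μ = ⊥ :=
  block_eq_bot_of_of_smul_eq (LiuDictionary.ofTower hHD hI h₁ h₃ hA V Char Adm Ω PhiMu adm).toLiuAlbaneseModuleDatum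
    (TowerLevel.ρ V γ) c hc hΩ (ofTower_rationalScalar_smul_eq hHD hI h₁ h₃ hA γ hz hγz)

end TowerDictionary

end Summit.HodgeConjecture.CorCM.Transposition.TowerCentre

end
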